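import Summits.NavierStokesRegularity.NavierStokesRegularity.Theses.ContinuousAlignment
import HarnessLib.Audit

/-!
# Birth skeleton (BC3) of the crux `ContinuousAlignment.AprioriContinuousAlignment`

Crux item `stmt-NavierStokesRegularity-18585` (decl
`Summit.NavierStokesRegularity.NavierStokesRegularity.Theses.ContinuousAlignment.AprioriContinuousAlignment`,
crux rank 3 of route `route-NavierStokesRegularity-ContinuousAlignment`, route file rev 1, re-audit bin HONEST; it
is the route's declared RESIDUAL conjunct W1 of the conjunct split `S ⟺ W1 ∧ W2`, W2 =
`ContinuousAlignmentCriterion` being the attacked conjunct). Tree path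
`Cruxes/AprioriContinuousAlignment/Lines/birth.lean`; registrar `planner-skel-stmt-NavierStokesRegularity-18585-0`,
2026-08-17 (skeleton-register one-shot).

PROVENANCE. Item 18585 is the rev-1 RESTATEMENT of the retired item `stmt-NavierStokesRegularity-18335` made by the
cone repair of 2026-08-17 (route rev 1, commit 7ac4b60b): the route file no longer imports
`Literature.Analysis.FluidPDE.Vorticity`, so the direction `ξ = ω/|ω|` is written INLINE as `‖ω x‖⁻¹ • ω x`
(definitionally `vorticityDirection ω x`, `rfl`). This file is the rev-1 form of the skeleton registered and vetted
PASS on 18335 (stubs `stub_regularAligned` / `stub_singularAligned`, by cases on continuation past `T` — the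
route header's own TWO-LAYER PLAN "W1 ⇐ RegularAligned → SingularAligned → W1"): the two stub signatures are the
18335 signatures with `vorticityDirection (curl (u t)) x` replaced by its unfolding `‖curl (u t) x‖⁻¹ • curl (u t) x`,
so that they peel the rev-1 crux text VERBATIM and the file needs no import beyond the route module. Nothing here is
new mathematics.

THE CRUX (W1, a-priori continuous alignment). For `ν, T > 0` and every classical Navier–Stokes solution `(u, p)` on
`ℝ³ × [0, T)` (`f = 0`) that is Leray–Hopf on `[0, T)` from its rapidly decaying datum `u 0`, and EVERY threshold
`d > 0`: the vorticity direction `ξ = ω/|ω|`, `ω = curl (u t)`, has a `t`-uniform spatial modulus of continuity on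
the high set `{|ω(t,·)| > d}`, measured by the sign-insensitive sine `√(1 − ⟪ξ(t,x), ξ(t,y)⟫²)`:
`∀ ε > 0 ∃ δ > 0 ∀ t ∈ [0,T) ∀ x y, |ω(t,x)|, |ω(t,y)| > d ∧ ‖x − y‖ < δ ⇒ sine ≤ ε`.

THE CUT (by cases on continuation past `T`; two named stubs):

* `stub_regularAligned` (M/L, PROVABLE NOW — the regular case). Extra hypothesis
  `HasSmoothExtensionPast ν 0 u T`. Content: a classical solution that is Leray–Hopf from a rapidly decaying datum
  and continues classically past `T` coincides on `[0, T)` with Kato's mild solution (weak–strong uniqueness,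
  in-tree `weak_strong_uniqueness_holds`), whose maximal time then exceeds `T` (else the singular point `(T, x₀)` of
  a maximal Kato solution, in-tree `lemarieRieusset_singular_point_of_blowup_holds`, contradicts the joint
  smoothness of the extension across `t = T` near `x₀`), so `∇ω` is bounded on the closed slab `[0, T] × ℝ³`, say
  by `L` (far field: `KatoFarFieldBound`; near `t = 0`: the datum's `C²` decay, `HasRapidSpatialDecay (u 0)` with
  `n = 2`); then the pointwise geometry of unit vectors
  `√(1 − ⟪ξx, ξy⟫²) ≤ ‖ξx − ξy‖ ≤ 2‖ω(x) − ω(y)‖/d ≤ 2L‖x − y‖/d` (for `|ω(x)|, |ω(y)| > d`) gives `δ = εd/(2L)`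
  (`δ = 1` if `L = 0`). Why plausibly true: it is true (the only issue is `t`-uniformity up to `T`, settled by
  `T_max > T`).
* `stub_singularAligned` (XL, OPEN — the whole open content of W1, honestly isolated). Extra hypothesis
  `¬ HasSmoothExtensionPast ν 0 u T` (a first blow-up at `T`). Content: "a blow-up cannot be scale-invariant in
  direction at a fixed vorticity level". Only a-priori inputs in hand: the max-point alignment inequality
  `D⁺‖ω‖∞ ≤ (α − ν|∇ξ|²)‖ω‖∞` and Constantin's energy-class budget `∫∫ |ω||∇ξ|² ≤ ½ν⁻²‖u₀‖²₂` (Constantin1990),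
  neither of which yields a uniform modulus (energy-supercritical:
  `Literature.Barriers.NavierStokesRegularity.EnergySupercriticality`). Why it might fail (filed on the item): a
  discretely self-similar / Type-II collapse with direction pattern `ξ ≈ Ξ((x − x*)/ℓ(t))`, `ℓ → 0`, has no
  `t`-uniform modulus; skewed tube collisions shrink the alignment scale before reconnecting (MoffattKimura2019,
  Hou2022). It is implied by no-blow-up by vacuity — consistent with W1 being the declared residual conjunct: no
  engine is claimed for it by the route.

`AprioriContinuousAlignment_of : ContinuousAlignment.AprioriContinuousAlignment` is the ONLY theorem of this file
concluding the crux (A12 layer invariant of `#h21_check_skeleton`: conclusion = the crux BY NAME, no `Prop`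
hypotheses, the only placeholders sit inside the two declared `stub_*` theorems, which it uses by name). Proof:
`by_cases` on `HasSmoothExtensionPast ν 0 u T`; it is the implication
`stub_regularAligned-statement → stub_singularAligned-statement → AprioriContinuousAlignment` applied to the stubs.

HONEST NOTE (case peel). The seam is the excluded middle on continuation past `T`: all open content sits in
`stub_singularAligned`; `stub_regularAligned` is a genuine but provable lemma (identification with the Kato solution
+ closed-slab `C²` bounds + unit-vector geometry), not bookkeeping. Neither stub is cheaply the crux or the summit —
BC3 probes (registrar folder `bc/probe_{regular,singular}_{crux,summit}.lean`, quoted in `Lines/birth.md`): for each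
stub `S`, `S → AprioriContinuousAlignment` and `S → NavierStokesRegularity` by
`first | exact? | simpa [defs] | (unfold defs; simpa) | aesop` FAIL.

Disproof used: none exists for this crux (`ledger crux ls stmt-NavierStokesRegularity-18585`: only the 18335 birth
files before this one; no `Disproof.lean`, no `Negative/` lemma); `ledger negatives --problem NavierStokesRegularity`
consulted — no refuted statement of the summit is an instance of either stub.
-/

noncomputable section

-- the summit and its single sub-problem share the name `NavierStokesRegularity` (D-0017 nested layout)
set_option linter.dupNamespace false
set_option linter.unusedVariables false

namespace Summit.NavierStokesRegularity.NavierStokesRegularity.Cruxes.AprioriContinuousAlignment.Birth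

open Set
open Literature.Analysis.FluidPDE

/-! ## Stubs -/

/-- **stub 1 — `stub_regularAligned` (M/L, PROVABLE NOW).**
The REGULAR case of W1: if the classical solution on `ℝ³ × [0, T)` (Leray–Hopf from its rapidly decaying datum)
extends classically past `T`, then for every `d > 0` the vorticity direction has a `t`-uniform modulus of
continuity (sine form) on `{|ω| > d}`, `t ∈ [0, T)`. Route: identification with the Kato mild solution, whose
maximal time exceeds `T`; uniform bound `L` of `∇ω` on the closed slab `[0, T] × ℝ³`; then
`√(1 − ⟪ξx, ξy⟫²) ≤ ‖ξx − ξy‖ ≤ 2‖ω(x) − ω(y)‖/d ≤ 2L‖x − y‖/d`, `δ := εd/(2L)`. -/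
theorem stub_regularAligned :
    ∀ (ν T : ℝ), 0 < ν → 0 < T →
      ∀ (u : ℝ → EuclideanSpace ℝ (Fin 3) → EuclideanSpace ℝ (Fin 3)) (p : ℝ → EuclideanSpace ℝ (Fin 3) → ℝ),
        Literature.Analysis.FluidPDE.IsClassicalNSSolutionOn (Set.Ico 0 T) ν 0 u p →
        Literature.Analysis.FluidPDE.IsLerayHopfOn T ν 0 (u 0) u →
        Literature.Analysis.FluidPDE.HasRapidSpatialDecay (u 0) →
        Literature.Analysis.FluidPDE.HasSmoothExtensionPast ν 0 u T →
        ∀ d : ℝ, 0 < d → ∀ ε : ℝ, 0 < ε → ∃ δ : ℝ, 0 < δ ∧ ∀ t ∈ Set.Ico 0 T,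
          ∀ x y : EuclideanSpace ℝ (Fin 3),
            d < ‖Literature.Analysis.FluidPDE.curl (u t) x‖ → d < ‖Literature.Analysis.FluidPDE.curl (u t) y‖ →
            ‖x - y‖ < δ →
            Real.sqrt (1 - (inner ℝ
              (‖Literature.Analysis.FluidPDE.curl (u t) x‖⁻¹ • Literature.Analysis.FluidPDE.curl (u t) x)
              (‖Literature.Analysis.FluidPDE.curl (u t) y‖⁻¹ • Literature.Analysis.FluidPDE.curl (u t) y)) ^ 2)
              ≤ ε := by
  sorry

/-- **stub 2 — `stub_singularAligned` (XL, OPEN — the open content of W1).** The SINGULAR case of W1: if the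
classical solution on `ℝ³ × [0, T)` (Leray–Hopf from its rapidly decaying datum) does NOT extend classically past
`T` (first blow-up at `T`), then still, for every `d > 0`, the vorticity direction has a `t`-uniform modulus of
continuity (sine form) on `{|ω| > d}`, `t ∈ [0, T)` — "a blow-up cannot be scale-invariant in direction at a fixed
vorticity level". A-priori inputs in hand: max-point alignment inequality, Constantin1990 budget
`∫∫ |ω||∇ξ|² ≤ ½ν⁻²‖u₀‖²₂` (energy class; does not give a uniform modulus). STATUS: open (residual conjunct; implied
by no-blow-up by vacuity). -/
theorem stub_singularAligned :
    ∀ (ν T : ℝ), 0 < ν → 0 < T →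
      ∀ (u : ℝ → EuclideanSpace ℝ (Fin 3) → EuclideanSpace ℝ (Fin 3)) (p : ℝ → EuclideanSpace ℝ (Fin 3) → ℝ),
        Literature.Analysis.FluidPDE.IsClassicalNSSolutionOn (Set.Ico 0 T) ν 0 u p →
        Literature.Analysis.FluidPDE.IsLerayHopfOn T ν 0 (u 0) u →
        Literature.Analysis.FluidPDE.HasRapidSpatialDecay (u 0) →
        ¬ Literature.Analysis.FluidPDE.HasSmoothExtensionPast ν 0 u T →
        ∀ d : ℝ, 0 < d → ∀ ε : ℝ, 0 < ε → ∃ δ : ℝ, 0 < δ ∧ ∀ t ∈ Set.Ico 0 T,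
          ∀ x y : EuclideanSpace ℝ (Fin 3),
            d < ‖Literature.Analysis.FluidPDE.curl (u t) x‖ → d < ‖Literature.Analysis.FluidPDE.curl (u t) y‖ →
            ‖x - y‖ < δ →
            Real.sqrt (1 - (inner ℝ
              (‖Literature.Analysis.FluidPDE.curl (u t) x‖⁻¹ • Literature.Analysis.FluidPDE.curl (u t) x)
              (‖Literature.Analysis.FluidPDE.curl (u t) y‖⁻¹ • Literature.Analysis.FluidPDE.curl (u t) y)) ^ 2)
              ≤ ε := by
  sorry

/-! ## Composition -/

/-- **Birth composition (the skeleton theorem).** The crux `AprioriContinuousAlignment` BY NAME from the two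
registered stubs, used by name: excluded middle on `HasSmoothExtensionPast ν 0 u T` — the regular case is
`stub_regularAligned`, the singular case `stub_singularAligned`. No `Prop` hypotheses; no placeholder outside
the stubs. -/
theorem AprioriContinuousAlignment_of :
    _root_.Summit.NavierStokesRegularity.NavierStokesRegularity.Theses.ContinuousAlignment.AprioriContinuousAlignment := by
  intro ν T hν hT u p hcl hLH hdec d hd ε hε
  by_cases hext : Literature.Analysis.FluidPDE.HasSmoothExtensionPast ν 0 u T
  · exact stub_regularAligned ν T hν hT u p hcl hLH hdec hext d hd ε hε
  · exact stub_singularAligned ν T hν hT u p hcl hLH hdec hext d hd ε hε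

end Summit.NavierStokesRegularity.NavierStokesRegularity.Cruxes.AprioriContinuousAlignment.Birth

end
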